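import Mathlib.NumberTheory.Zsqrtd.GaussianInt
import Mathlib.Algebra.BigOperators.Group.Finset.Basic
import Mathlib.Data.Int.Interval
import Mathlib.Data.Set.Card
import Mathlib.Tactic.Linarith
import Mathlib.Tactic.Ring
import Literature.Algebra.EuclideanDomain.MotzkinConstruction
import Literature.NumberTheory.QuadraticFields.GaussianDigitExpansions
import Literature.NumberTheory.QuadraticFields.GaussianMinimalEuclideanFunction
import HarnessLib

/-!
# Sizes of the pre-images of the minimal Euclidean function on `ℤ[i]` (Graves 2026)

Topic `Literature/NumberTheory/QuadraticFields`, namespace `Literature.NumberTheory.QuadraticFields.GaussianDigits`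
(Gaussian integers = Mathlib's `ℤ√(-1)`).  Two definitions with bodies (the lattice octagons `E_{a,b}` of
Def. 2.1 and the sets `S_n` of Def. 2.3), everything else PROVED; no instance, no named fact.  Fourth file on
Graves' `(1+i)`-ary digit sets, after `GaussianDigitExpansions.lean` (`B_n = digitSet n`, `w_n = width n`,
`Oct_n = octagon n`, Theorem 2.5), `GaussianTwoSquaresResidueSystem.lean` and
`GaussianMinimalEuclideanFunction.lean` (Theorem 5.3: `φ_{ℤ[i]}(z) ≤ n ↔ z ∈ B_n`, `motzkinNorm_le_iff_mem_digitSet`).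

## Source (read in full)

H. Graves, *Sizes of pre-images of the minimal Euclidean function on the Gaussian integers*, arXiv:2603.13225
(2026) [Graves2026] (materialised `paper:arxiv-2603.13225`), VERBATIM:
* Def. 2.1: «Suppose `a` and `b` are integers, where `0 < a < b < 2a`.  We define
  `E_{a,b} := {x+yi : |x|, |y| ≤ a, |x| + |y| ≤ b}`.»  Def. 2.2: `w_n = 3·2^k` (`n = 2k`), `4·2^k` (`n = 2k+1`).
  Def. 2.3: «`Oct_n = E_{w_n−2, w_{n+1}−3}` and `S_n := {x+yi ∈ Oct_n : 2 ∤ gcd(x,y)}`.»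
* Thm. 2.4 (= [Graves2023], via Thm. 2.5 there): «`φ_{ℤ[i]}^{-1}([0,n]) ∖ {0} = ⊔_{j=0}^{⌊n/2⌋} 2^j S_{n−2j}`.»
  Cor. 2.5: «`a_{n+1} = |φ_{ℤ[i]}^{-1}([0,n])| = 1 + Σ_{j=0}^{⌊n/2⌋} |S_{n−2j}|`.»
* Lemma 3.1: «The number of points in `E_{a,b}` is `1 + 4a + 4a² − 2(2a−b)(2a−b+1)`.»
  Cor. 3.2: «`|Oct_n| = 1 + 4(w_n−2) + 4(w_n−2)² − 2(w_{n+2} − w_{n+1})(w_{n+2} − w_{n+1} − 1)`.»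
  («`|Oct₀| = 5`, `|Oct₁| = 21`, `|Oct₂| = 57`, `|Oct₃| = 145`.»)
* Lemma 3.3: «For `n ≥ 1`, the number of points `x+yi ∈ Oct_n` where `2 | gcd(x,y)` is
  `1 + 2(w_n−2) + (w_n−2)² − 2(w_n − w_{n−1})(w_n − w_{n−1} + 1)`.»
* Lemma 3.4: «`|S_n| = 2(w_n−2) + 3(w_n−2)² − 6(w_n − w_{n−1})(w_n − w_{n−1} − 1)`» (for `n ≥ 1`; «Direct
  computation shows `|S₀| = 4`.  After that, the lemma gives us the sequence `|S₁| = 16`, `|S₂| = 44`, and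
  `|S₃| = 108`.»)
* Thm. 4.1: «For `k ≥ 1`, `|φ_{ℤ[i]}^{-1}([0,2k])| = 25 + 8k − 48·2^k + 28·4^k`.»
* Thm. 4.2: «For `k ≥ 1`, `|φ_{ℤ[i]}^{-1}([0,2k+1])| = 29 + 8k − 68·2^k + 28·4^k`.»  **MISPRINT**: the leading
  constant is `56`, not `28` — the proof's own penultimate line reads «`= 9 + 8k − 68·2^k + 34 + 14·4^{k+1} − 14`»
  `= 29 + 8k − 68·2^k + 56·4^k`, the paper's closing remark «according to Robert Israel's formula,
  `|φ^{-1}([0,2k+1])| = a(2k+2)`» with Israel's «`a(2k) = 14·4^k − 34·2^k + 8k + 21`» gives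
  `a(2k+2) = 56·4^k − 68·2^k + 8k + 29`, and `|B₁| = 17`, `|B₃| = 125` (the value `28` would give `−11` and `13`).
  We prove the corrected statement (`ncard_digitSet_two_mul_add_one`); both theorems in fact hold for all `k ≥ 0`.

## Dictionary and proof

`φ_{ℤ[i]}^{-1}([0,n]) = B_n = digitSet n` (`setOf_motzkinNorm_le_eq_digitSet`, from Theorem 5.3 of
[Graves2023] = `motzkinNorm_le_iff_mem_digitSet`, with `φ(0) = 0`); `Oct_n = E_{w_n−2,w_{n+1}−3}` is
`octagon_eq_latticeOctagon` (definitional); `S_n = oddOctagon n`.  The proofs follow the paper: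
Lemma 3.1 by summing the rows of `E_{a,b}` (row `x` has `2·min(a, b−|x|) + 1` points; the closed form of the
sum is obtained by induction on `a` with `b − a` fixed rather than by the triangular-number picture);
Lemma 3.3 by halving the even points (`2·E_{⌊a/2⌋,⌊b/2⌋}`); Lemma 3.4 as `|Oct_n| −` (even points);
Theorems 4.1/4.2 by the recursion `B_{n+2} = S_{n+2} ⊔ 2B_n` (`digitSet_add_two_eq`, i.e. Cor. 2.5 /
Thm. 2.4, which rest on Theorem 2.5 of [Graves2023]: `two_mul_mem_digitSet_iff`,
`mem_digitSet_iff_mem_octagon_of_not_two_dvd`) and induction on `k` (instead of summing geometric series).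

## Main statements

`ncard_latticeOctagon` (Lemma 3.1), `ncard_octagon` (Cor. 3.2), `ncard_sep_even_octagon_succ` (Lemma 3.3),
`ncard_oddOctagon_succ` / `ncard_oddOctagon_zero` (Lemma 3.4), `mem_digitSet_iff_exists_two_pow_mul` /
`digitSet_diff_zero_eq_iUnion` / `two_pow_mul_eq_two_pow_mul_iff` (Thm. 2.4), `ncard_digitSet_add_two` /
`ncard_digitSet_eq_one_add_sum` (Cor. 2.5), **`ncard_digitSet_two_mul`** (Thm. 4.1:
`|B_{2k}| = 28·4^k − 48·2^k + 8k + 25`), **`ncard_digitSet_two_mul_add_one`** (Thm. 4.2 corrected: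
`|B_{2k+1}| = 56·4^k − 68·2^k + 8k + 29`), the same for `φ_{ℤ[i]}^{-1}([0,n])`
(`ncard_setOf_motzkinNorm_le_two_mul(_add_one)`), and the level sets `φ_{ℤ[i]}^{-1}(n)`
(`ncard_setOf_motzkinNorm_eq_*`: `5`, `28·4^k − 20·2^k + 4` at `2k+1`, `56·4^k − 28·2^k + 4` at `2k+2`), and
Lenstra's «`φ_{ℤ[i]}(z) = min{n : z` has an `(n+1)`-digit expansion`}`» (`isLeast_motzkinNorm(_expansion)`).

## Mathlib / tree search

Mathlib: `Finset.Icc` on `ℤ` (`Int.card_Icc`), `Finset.card_filter`, `Finset.sum_product`, `Set.ncard_*`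
(`Set.ncard_image_of_injective`, `Set.ncard_union_eq`, `Set.ncard_sdiff_add_ncard_of_subset`,
`Set.ncard_coe_finset`).  Tree: everything about `digitSet`/`width`/`octagon` from `GaussianDigitExpansions.lean`
(`width_shape`, `two_pow_mul_mem_digitSet_iff`, `two_pow_mul_not_mem_digitSet`, `exists_exact_two_pow`,
`exact_two_pow_unique`, `eq_two_pow_mul`, `mem_digitSet_iff_mem_octagon_of_not_two_dvd`),
`motzkinNorm_le_iff_mem_digitSet` from `GaussianMinimalEuclideanFunction.lean` (whose `ncard_digitSet_one : |B₁| = 17`,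
proved by listing, agrees with `|S₁| + 1` here), `motzkinRank_eq_zero_iff` from `MotzkinConstruction.lean`.  No prior formalisation of these counts in the tree (`rg ncard_digitSet|A005132`).
-/

namespace Literature.NumberTheory.QuadraticFields.GaussianDigits

open _root_.Zsqrtd Literature.Algebra.EuclideanDomain

/-! ## §1 The lattice octagons `E_{a,b}` (Definition 2.1) and their point count (Lemma 3.1) -/

/-- **`E_{a,b}`** `:= {x+yi : |x|, |y| ≤ a, |x| + |y| ≤ b}` (the paper assumes `0 < a < b < 2a`; the definition
makes sense for all `a, b`). [cite: Graves2026, Def. 2.1] -/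
def latticeOctagon (a b : ℤ) : Set (ℤ√(-1)) := {z | |z.re| ≤ a ∧ |z.im| ≤ a ∧ |z.re| + |z.im| ≤ b}

/-- Membership in `E_{a,b}`, by definition. [cite: Graves2026, Def. 2.1] -/
theorem mem_latticeOctagon_iff {a b : ℤ} {z : ℤ√(-1)} :
    z ∈ latticeOctagon a b ↔ |z.re| ≤ a ∧ |z.im| ≤ a ∧ |z.re| + |z.im| ≤ b := Iff.rfl

/-- «`Oct_n = E_{w_n−2, w_{n+1}−3}`» (definitionally, for the tree's `octagon`). [cite: Graves2026, Def. 2.3] -/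
theorem octagon_eq_latticeOctagon (n : ℕ) : octagon n = latticeOctagon (width n - 2) (width (n + 1) - 3) := rfl

/-- The lattice-point model of `E_{a,b}` in `ℤ × ℤ`, used for counting. [folklore] -/
private def octagonPoints (a b : ℤ) : Finset (ℤ × ℤ) :=
  (Finset.Icc (-a) a ×ˢ Finset.Icc (-a) a).filter fun p ↦ |p.1| + |p.2| ≤ b

/-- Membership in the lattice-point model. [folklore] -/
private theorem mem_octagonPoints {a b : ℤ} {p : ℤ × ℤ} :
    p ∈ octagonPoints a b ↔ |p.1| ≤ a ∧ |p.2| ≤ a ∧ |p.1| + |p.2| ≤ b := by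
  simp only [octagonPoints, Finset.mem_filter, Finset.mem_product, Finset.mem_Icc, abs_le, and_assoc]

/-- `E_{a,b}` is the image of its lattice-point model under `(x, y) ↦ x + yi`. [folklore] -/
private theorem latticeOctagon_eq_image (a b : ℤ) :
    latticeOctagon a b = (fun p : ℤ × ℤ ↦ (⟨p.1, p.2⟩ : ℤ√(-1))) '' (octagonPoints a b : Set (ℤ × ℤ)) := by
  ext z
  simp only [mem_latticeOctagon_iff, Set.mem_image, Finset.mem_coe, mem_octagonPoints]
  constructor
  · intro h
    exact ⟨(z.re, z.im), h, by ext <;> rfl⟩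
  · rintro ⟨p, hp, rfl⟩
    exact hp

/-- `(x, y) ↦ x + yi` is injective. [folklore] -/
private theorem mk_injective : Function.Injective fun p : ℤ × ℤ ↦ (⟨p.1, p.2⟩ : ℤ√(-1)) := by
  intro p q h
  simp only [Zsqrtd.ext_iff] at h
  exact Prod.ext h.1 h.2

/-- `E_{a,b}` is finite. [cite: Graves2026, Def. 2.1] -/
theorem latticeOctagon_finite (a b : ℤ) : (latticeOctagon a b).Finite := by
  rw [latticeOctagon_eq_image]
  exact (Finset.finite_toSet _).image _

/-- `Oct_n` is finite. [cite: Graves2026, Def. 2.3] -/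
theorem octagon_finite (n : ℕ) : (octagon n).Finite := latticeOctagon_finite _ _

/-- `B_n ⊆ Oct_n` is finite. [cite: Graves2026, Thm. 2.4] -/
theorem digitSet_finite (n : ℕ) : (digitSet n).Finite := (octagon_finite n).subset (digitSet_subset_octagon n)

/-- Counting a filtered product by rows. [folklore] -/
private theorem card_filter_product {α β : Type*} (s : Finset α) (t : Finset β) (P : α × β → Prop)
    [DecidablePred P] :
    ((s ×ˢ t).filter P).card = ∑ x ∈ s, (t.filter fun y ↦ P (x, y)).card := by
  simp only [Finset.card_filter, Finset.sum_product]

/-- The row of `E_{a,b}` above `x` is the interval `|y| ≤ min(a, b − |x|)`. [cite: Graves2026, Lemma 3.1 (proof)] -/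
private theorem row_eq (a b x : ℤ) :
    (Finset.Icc (-a) a).filter (fun y ↦ |x| + |y| ≤ b) =
      Finset.Icc (-min a (b - |x|)) (min a (b - |x|)) := by
  ext y
  simp only [Finset.mem_filter, Finset.mem_Icc]
  have := abs_le (a := y) (b := b - |x|)
  have h2 := abs_le (a := y) (b := a)
  omega

/-- `|E_{a,b}| = Σ_{|x| ≤ a} (2·min(a, b−|x|) + 1)` for `0 ≤ a ≤ b` («`Σ_{|x| ≤ a} Σ_{|y| ≤ a, |x|+|y| ≤ b} 1`»).
[cite: Graves2026, Lemma 3.1 (proof)] -/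
private theorem card_octagonPoints_eq_sum (a b : ℤ) (ha : 0 ≤ a) (hab : a ≤ b) :
    ((octagonPoints a b).card : ℤ) = ∑ x ∈ Finset.Icc (-a) a, (2 * min a (b - |x|) + 1) := by
  rw [octagonPoints, card_filter_product, Nat.cast_sum]
  refine Finset.sum_congr rfl fun x hx ↦ ?_
  rw [Finset.mem_Icc] at hx
  have hx' : |x| ≤ a := abs_le.mpr ⟨hx.1, hx.2⟩
  rw [row_eq, Int.card_Icc]
  have : 0 ≤ min a (b - |x|) := le_min ha (by omega)
  omega

/-- The row sum in closed form, by induction on `a = c + j` with `c = b − a` fixed: passing from `a` to `a+1`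
every old row gains two points and two new rows of `2c+1` points appear. [cite: Graves2026, Lemma 3.1 (proof)] -/
private theorem rowsum_eq (c : ℤ) (hc : 0 ≤ c) (j : ℕ) :
    ∑ x ∈ Finset.Icc (-(c + j)) (c + j), (2 * min (c + j) (c + j + c - |x|) + 1) =
      2 * (c + j) ^ 2 + 4 * (c + j) * c - 2 * c ^ 2 + 2 * (c + j) + 2 * c + 1 := by
  induction j with
  | zero =>
    simp only [Nat.cast_zero, add_zero]
    rw [Finset.sum_congr rfl fun x hx ↦ (?_ : 2 * min c (c + c - |x|) + 1 = 2 * c + 1), Finset.sum_const,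
      Int.card_Icc, nsmul_eq_mul]
    · have : (c + 1 - -c).toNat = 2 * c + 1 := by omega
      rw [this]; ring
    · rw [Finset.mem_Icc] at hx
      have hx' : |x| ≤ c := abs_le.mpr ⟨hx.1, hx.2⟩
      omega
  | succ j ih =>
    have hI : Finset.Icc (-(c + ((j + 1 : ℕ) : ℤ))) (c + ((j + 1 : ℕ) : ℤ)) =
        insert (-(c + j + 1)) (insert (c + j + 1) (Finset.Icc (-(c + j)) (c + j))) := by
      ext x
      simp only [Finset.mem_Icc, Finset.mem_insert, Nat.cast_add, Nat.cast_one]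
      omega
    rw [hI, Finset.sum_insert, Finset.sum_insert]
    rotate_left
    · simp only [Finset.mem_Icc]; omega
    · simp only [Finset.mem_insert, Finset.mem_Icc]; omega
    rw [Finset.sum_congr rfl fun x hx ↦ (?_ : 2 * min (c + ((j + 1 : ℕ) : ℤ)) (c + ((j + 1 : ℕ) : ℤ) + c - |x|) + 1
        = (2 * min (c + j) (c + j + c - |x|) + 1) + 2), Finset.sum_add_distrib, ih, Finset.sum_const, Int.card_Icc,
      nsmul_eq_mul]
    · have h1 : |(-(c + ↑j + 1))| = c + j + 1 := by rw [abs_neg]; exact abs_of_nonneg (by positivity)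
      have h2 : |(c + ↑j + 1)| = c + j + 1 := abs_of_nonneg (by positivity)
      rw [h1, h2]
      have : (c + ↑j + 1 - -(c + ↑j)).toNat = 2 * (c + j) + 1 := by omega
      rw [this]
      push_cast
      have hm : min (c + (↑j + 1)) (c + (↑j + 1) + c - (c + ↑j + 1)) = c := by
        rw [min_eq_right (by omega)]; ring
      rw [hm]; ring
    · push_cast; omega

/-- Lemma 3.1 for the lattice-point model. [cite: Graves2026, Lemma 3.1] -/
private theorem card_octagonPoints {a b : ℤ} (ha : 0 ≤ a) (hab : a ≤ b) (hba : b ≤ 2 * a) :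
    ((octagonPoints a b).card : ℤ) = 1 + 4 * a + 4 * a ^ 2 - 2 * (2 * a - b) * (2 * a - b + 1) := by
  rw [card_octagonPoints_eq_sum a b ha hab]
  obtain ⟨j, hj⟩ := Int.le.dest (show b - a ≤ a by omega)
  have hc : 0 ≤ b - a := by omega
  have key := rowsum_eq (b - a) hc j
  rw [hj] at key
  rw [Finset.sum_congr rfl fun x _ ↦ (?_ : 2 * min a (b - |x|) + 1 = 2 * min a (a + (b - a) - |x|) + 1), key]
  · rw [← hj]; ring
  · rw [add_sub_cancel]

/-- **Lemma 3.1.** «The number of points in `E_{a,b}` is `1 + 4a + 4a² − 2(2a−b)(2a−b+1)`» (for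
`0 ≤ a ≤ b ≤ 2a`; the paper takes `0 < a < b < 2a`). [cite: Graves2026, Lemma 3.1] -/
theorem ncard_latticeOctagon {a b : ℤ} (ha : 0 ≤ a) (hab : a ≤ b) (hba : b ≤ 2 * a) :
    ((latticeOctagon a b).ncard : ℤ) = 1 + 4 * a + 4 * a ^ 2 - 2 * (2 * a - b) * (2 * a - b + 1) := by
  rw [latticeOctagon_eq_image, Set.ncard_image_of_injective _ mk_injective, Set.ncard_coe_finset]
  exact card_octagonPoints ha hab hba

/-- The paper's figure: `|E_{5,6}| = 81`. [cite: Graves2026, §2 (Figure `E_{5,6}`)] -/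
theorem ncard_latticeOctagon_five_six : (latticeOctagon 5 6).ncard = 81 := by
  have := ncard_latticeOctagon (a := 5) (b := 6) (by norm_num) (by norm_num) (by norm_num)
  norm_num at this
  exact_mod_cast this

/-- **Corollary 3.2.** «`|Oct_n| = 1 + 4(w_n−2) + 4(w_n−2)² − 2(w_{n+2} − w_{n+1})(w_{n+2} − w_{n+1} − 1)`.»
[cite: Graves2026, Cor. 3.2] -/
theorem ncard_octagon (n : ℕ) : ((octagon n).ncard : ℤ) =
    1 + 4 * (width n - 2) + 4 * (width n - 2) ^ 2
      - 2 * (width (n + 2) - width (n + 1)) * (width (n + 2) - width (n + 1) - 1) := by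
  have h3 := three_le_width n
  have h1 := width_lt_width_succ n
  have h2 := width_lt_width_succ (n + 1)
  rw [octagon_eq_latticeOctagon, ncard_latticeOctagon (by omega) (by omega) (by rw [width_add_two] at h2; omega),
    width_add_two]
  ring

/-- «We see `|Oct₀| = 5`, `|Oct₁| = 21`, `|Oct₂| = 57`, and `|Oct₃| = 145`.» [cite: Graves2026, Cor. 3.2 (Examples)] -/
theorem ncard_octagon_examples :
    (octagon 0).ncard = 5 ∧ (octagon 1).ncard = 21 ∧ (octagon 2).ncard = 57 ∧ (octagon 3).ncard = 145 := by
  have h0 := ncard_octagon 0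
  have h1 := ncard_octagon 1
  have h2 := ncard_octagon 2
  have h3 := ncard_octagon 3
  simp only [width_add_two, width_zero, width_one, zero_add] at h0 h1 h2 h3
  norm_num at h0 h1 h2 h3
  exact ⟨by exact_mod_cast h0, by exact_mod_cast h1, by exact_mod_cast h2, by exact_mod_cast h3⟩

/-! ## §2 Even points (Lemma 3.3) and the sets `S_n` (Definition 2.3, Lemma 3.4) -/

/-- The even points of `E_{a,b}` are `2 · E_{⌊a/2⌋, ⌊b/2⌋}` («Since `2j`, `2l`, and `w_{n+1}` are all even, …
we can therefore rewrite the sum as … `E_{w_{n−2}−1, w_{n−1}−2}`»). [cite: Graves2026, Lemma 3.3 (proof)] -/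
private theorem sep_even_latticeOctagon_eq (a b : ℤ) :
    {z ∈ latticeOctagon a b | 2 ∣ z.re ∧ 2 ∣ z.im} = (fun z ↦ 2 * z) '' latticeOctagon (a / 2) (b / 2) := by
  ext z
  simp only [Set.mem_setOf_eq, mem_latticeOctagon_iff, Set.mem_image]
  constructor
  · rintro ⟨⟨h1, h2, h3⟩, ⟨x, hx⟩, ⟨y, hy⟩⟩
    refine ⟨⟨x, y⟩, ?_, Zsqrtd.ext (by simp [hx]) (by simp [hy])⟩
    rw [hx] at h1 h3
    rw [hy] at h2 h3
    rw [abs_mul, abs_two] at h1 h2 h3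
    rw [abs_mul, abs_two] at h3
    dsimp only
    omega
  · rintro ⟨w, ⟨h1, h2, h3⟩, rfl⟩
    have hre : (2 * w).re = 2 * w.re := by simp
    have him : (2 * w).im = 2 * w.im := by simp
    rw [hre, him, abs_mul, abs_mul, abs_two]
    refine ⟨⟨?_, ?_, ?_⟩, ⟨w.re, rfl⟩, ⟨w.im, rfl⟩⟩ <;> omega

/-- Doubling is injective on `ℤ[i]`. [folklore] -/
private theorem two_mul_injective : Function.Injective fun z : ℤ√(-1) ↦ 2 * z :=
  fun _ _ h ↦ mul_left_cancel₀ (by decide) h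

/-- `w_{n+1}` is even, `w_{n+1} = 2h`, with `h + 1 ≤ w_n ≤ 2h` (`h = w_{n−1}` for `n ≥ 1`, `h = 2` for `n = 0`).
[cite: Graves2026, Def. 2.2] -/
theorem exists_width_succ_eq_two_mul (n : ℕ) :
    ∃ h : ℤ, width (n + 1) = 2 * h ∧ h + 1 ≤ width n ∧ width n ≤ 2 * h := by
  obtain ⟨K, hK, ⟨h1, h2⟩ | ⟨h1, h2⟩⟩ := width_shape n
  · have : (1 : ℤ) ≤ K := by rw [hK]; exact one_le_pow₀ (by norm_num)
    exact ⟨2 * K, by rw [h2]; ring, by rw [h1]; omega, by rw [h1]; omega⟩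
  · have : (1 : ℤ) ≤ K := by rw [hK]; exact one_le_pow₀ (by norm_num)
    exact ⟨3 * K, by rw [h2]; ring, by rw [h1]; omega, by rw [h1]; omega⟩

/-- **Lemma 3.3** (stated for `Oct_{n+1}`, i.e. the paper's `n ≥ 1`): «the number of points `x+yi ∈ Oct_n` where
`2 | gcd(x,y)` is `1 + 2(w_n−2) + (w_n−2)² − 2(w_n − w_{n−1})(w_n − w_{n−1} + 1)`.» [cite: Graves2026, Lemma 3.3] -/
theorem ncard_sep_even_octagon_succ (n : ℕ) :
    (({z ∈ octagon (n + 1) | 2 ∣ z.re ∧ 2 ∣ z.im}).ncard : ℤ) =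
      1 + 2 * (width (n + 1) - 2) + (width (n + 1) - 2) ^ 2
        - 2 * (width (n + 1) - width n) * (width (n + 1) - width n + 1) := by
  obtain ⟨h, hh, hle, hge⟩ := exists_width_succ_eq_two_mul n
  have h3 := three_le_width n
  rw [octagon_eq_latticeOctagon, sep_even_latticeOctagon_eq,
    Set.ncard_image_of_injective _ two_mul_injective, width_add_two,
    show (width (n + 1) - 2) / 2 = h - 1 by omega, show (2 * width n - 3) / 2 = width n - 2 by omega,
    ncard_latticeOctagon (by omega) (by omega) (by omega), hh]
  ring

/-- **`S_n`** `:= {x+yi ∈ Oct_n : 2 ∤ gcd(x,y)}` (the points of `Oct_n` with `x`, `y` not both even).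
[cite: Graves2026, Def. 2.3] -/
def oddOctagon (n : ℕ) : Set (ℤ√(-1)) := {z ∈ octagon n | ¬(2 ∣ z.re ∧ 2 ∣ z.im)}

/-- Membership in `S_n`, by definition. [cite: Graves2026, Def. 2.3] -/
theorem mem_oddOctagon_iff {n : ℕ} {z : ℤ√(-1)} :
    z ∈ oddOctagon n ↔ z ∈ octagon n ∧ ¬(2 ∣ z.re ∧ 2 ∣ z.im) := Iff.rfl

/-- `S_n = Oct_n ∖ (even points)`. [cite: Graves2026, Lemma 3.4 (proof)] -/
theorem oddOctagon_eq_sdiff (n : ℕ) :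
    oddOctagon n = octagon n \ {z ∈ octagon n | 2 ∣ z.re ∧ 2 ∣ z.im} := by
  ext z
  simp only [mem_oddOctagon_iff, Set.mem_sdiff, Set.mem_sep_iff, not_and]
  tauto

/-- `S_n` is finite. [cite: Graves2026, Def. 2.3] -/
theorem oddOctagon_finite (n : ℕ) : (oddOctagon n).Finite := (octagon_finite n).subset fun _ h ↦ h.1

/-- `S_n = {z ∈ B_n : 2 ∤ z}` — Theorem 2.5 of [Graves2023] for points prime to `2` («These seemingly unmotivated
sets are important due to the following theorem»). [cite: Graves2026, Thm. 2.4] -/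
theorem mem_oddOctagon_iff_mem_digitSet {n : ℕ} {z : ℤ√(-1)} :
    z ∈ oddOctagon n ↔ z ∈ digitSet n ∧ ¬(2 ∣ z.re ∧ 2 ∣ z.im) := by
  rw [mem_oddOctagon_iff]
  constructor
  · rintro ⟨h, hodd⟩
    exact ⟨(mem_digitSet_iff_mem_octagon_of_not_two_dvd hodd).mpr h, hodd⟩
  · rintro ⟨h, hodd⟩
    exact ⟨mem_octagon_of_mem_digitSet h, hodd⟩

/-- **Lemma 3.4** (stated for `S_{n+1}`, i.e. the paper's `n ≥ 1`):
«`|S_n| = 2(w_n−2) + 3(w_n−2)² − 6(w_n − w_{n−1})(w_n − w_{n−1} − 1)`.» [cite: Graves2026, Lemma 3.4] -/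
theorem ncard_oddOctagon_succ (n : ℕ) : ((oddOctagon (n + 1)).ncard : ℤ) =
    2 * (width (n + 1) - 2) + 3 * (width (n + 1) - 2) ^ 2
      - 6 * (width (n + 1) - width n) * (width (n + 1) - width n - 1) := by
  have hsub : {z ∈ octagon (n + 1) | 2 ∣ z.re ∧ 2 ∣ z.im} ⊆ octagon (n + 1) := fun _ h ↦ h.1
  have := Set.ncard_sdiff_add_ncard_of_subset hsub (octagon_finite _)
  rw [← oddOctagon_eq_sdiff] at this
  have e1 := ncard_octagon (n + 1)
  have e2 := ncard_sep_even_octagon_succ n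
  rw [show n + 1 + 2 = n + 3 by rfl, show n + 1 + 1 = n + 2 by rfl, show width (n + 3) = 2 * width (n + 1) from
    width_add_two (n + 1), width_add_two] at e1
  have : ((oddOctagon (n + 1)).ncard : ℤ) =
      (octagon (n + 1)).ncard - ({z ∈ octagon (n + 1) | 2 ∣ z.re ∧ 2 ∣ z.im}).ncard := by
    omega
  rw [this, e1, e2]
  ring

/-- `S₀ = {±1, ±i}`. [cite: Graves2026, Lemma 3.4 (Examples)] -/
theorem oddOctagon_zero_eq : oddOctagon 0 = (({1, -1, ⟨0, 1⟩, ⟨0, -1⟩} : Finset (ℤ√(-1))) : Set (ℤ√(-1))) := by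
  ext z
  rw [mem_oddOctagon_iff, mem_octagon_iff, width_zero, width_one]
  simp only [Finset.coe_insert, Finset.coe_singleton, Set.mem_insert_iff, Set.mem_singleton_iff]
  obtain ⟨x, y⟩ := z
  simp only [Zsqrtd.ext_iff, re_one, im_one, re_neg, im_neg, neg_zero]
  constructor
  · rintro ⟨⟨h1, h2, h3⟩, hodd⟩
    have := emod_two_eq_one_or_of_not_two_dvd hodd
    omega
  · rintro (⟨rfl, rfl⟩ | ⟨rfl, rfl⟩ | ⟨rfl, rfl⟩ | ⟨rfl, rfl⟩) <;> refine ⟨by decide, ?_⟩ <;> decide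

/-- «Direct computation shows `|S₀| = 4`.» [cite: Graves2026, Lemma 3.4 (Examples)] -/
theorem ncard_oddOctagon_zero : (oddOctagon 0).ncard = 4 := by
  rw [oddOctagon_zero_eq, Set.ncard_coe_finset]
  decide

/-- «the lemma gives us the sequence `|S₁| = 16`, `|S₂| = 44`, and `|S₃| = 108`.»
[cite: Graves2026, Lemma 3.4 (Examples)] -/
theorem ncard_oddOctagon_examples :
    (oddOctagon 1).ncard = 16 ∧ (oddOctagon 2).ncard = 44 ∧ (oddOctagon 3).ncard = 108 := by
  have h1 := ncard_oddOctagon_succ 0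
  have h2 := ncard_oddOctagon_succ 1
  have h3 := ncard_oddOctagon_succ 2
  simp only [width_add_two, width_zero, width_one, zero_add] at h1 h2 h3
  norm_num at h1 h2 h3
  exact ⟨by exact_mod_cast h1, by exact_mod_cast h2, by exact_mod_cast h3⟩

/-! ## §3 Theorem 2.4 and Corollary 2.5: `B_n ∖ 0 = ⊔_j 2^j S_{n−2j}`, `B_{n+2} = S_{n+2} ⊔ 2B_n` -/

/-- `B_{n+2} = S_{n+2} ∪ 2B_n`: a point of `B_{n+2}` is either prime to `2` (hence in `S_{n+2}`, Theorem 2.5) or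
twice a point of `B_n` (`2z ∈ B_{n+2} ↔ z ∈ B_n`). [cite: Graves2026, Thm. 2.4] -/
theorem digitSet_add_two_eq (n : ℕ) :
    digitSet (n + 2) = oddOctagon (n + 2) ∪ (fun z ↦ 2 * z) '' digitSet n := by
  ext z
  simp only [Set.mem_union, mem_oddOctagon_iff_mem_digitSet, Set.mem_image]
  constructor
  · intro hz
    by_cases hev : 2 ∣ z.re ∧ 2 ∣ z.im
    · obtain ⟨⟨a, ha⟩, ⟨b, hb⟩⟩ := hev
      have hzw : z = 2 * ⟨a, b⟩ := Zsqrtd.ext (by simpa using ha) (by simpa using hb)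
      rw [hzw, two_mul_mem_digitSet_iff] at hz
      exact Or.inr ⟨_, hz, hzw.symm⟩
    · exact Or.inl ⟨hz, hev⟩
  · rintro (⟨hz, _⟩ | ⟨w, hw, rfl⟩)
    · exact hz
    · exact two_mul_mem_digitSet_iff.mpr hw

/-- … and the union is disjoint («We use the disjoint union symbol because the sets are, indeed, disjoint»).
[cite: Graves2026, Thm. 2.4] -/
theorem disjoint_oddOctagon_image_two_mul (n m : ℕ) :
    Disjoint (oddOctagon m) ((fun z ↦ 2 * z) '' digitSet n) := by
  rw [Set.disjoint_left]
  rintro z ⟨_, hodd⟩ ⟨w, _, rfl⟩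
  exact hodd ⟨⟨w.re, by simp⟩, ⟨w.im, by simp⟩⟩

/-- **`|B_{n+2}| = |S_{n+2}| + |B_n|`** (the recursion behind Corollary 2.5). [cite: Graves2026, Cor. 2.5] -/
theorem ncard_digitSet_add_two (n : ℕ) :
    (digitSet (n + 2)).ncard = (oddOctagon (n + 2)).ncard + (digitSet n).ncard := by
  rw [digitSet_add_two_eq, Set.ncard_union_eq (disjoint_oddOctagon_image_two_mul n (n + 2)) (oddOctagon_finite _)
    ((digitSet_finite n).image _), Set.ncard_image_of_injective _ two_mul_injective]

/-- For `n ≤ 1` the only point of `B_n` divisible by `2` is `0`: `B₀ = S₀ ⊔ {0}`, `B₁ = S₁ ⊔ {0}` (Theorem 2.4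
with `⌊n/2⌋ = 0`). [cite: Graves2026, Thm. 2.4] -/
theorem digitSet_eq_oddOctagon_union_of_le_one {n : ℕ} (hn : n ≤ 1) : digitSet n = oddOctagon n ∪ {0} := by
  ext z
  simp only [Set.mem_union, mem_oddOctagon_iff_mem_digitSet, Set.mem_singleton_iff]
  constructor
  · intro hz
    by_cases hev : 2 ∣ z.re ∧ 2 ∣ z.im
    · obtain ⟨⟨a, ha⟩, ⟨b, hb⟩⟩ := hev
      have hzw : z = 2 * ⟨a, b⟩ := Zsqrtd.ext (by simpa using ha) (by simpa using hb)
      right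
      by_contra hne
      have hw : (⟨a, b⟩ : ℤ√(-1)) ≠ 0 := by rintro hw; rw [hw, mul_zero] at hzw; exact hne hzw
      exact two_mul_not_mem_digitSet_one hw (digitSet_mono hn (hzw ▸ hz))
    · exact Or.inl ⟨hz, hev⟩
  · rintro (⟨hz, _⟩ | rfl)
    · exact hz
    · exact zero_mem_digitSet n

/-- `|B_n| = |S_n| + 1` for `n ≤ 1` (`a(1) = 1 + |S₀|`, `a(2) = 1 + |S₁|`). [cite: Graves2026, Cor. 2.5] -/
theorem ncard_digitSet_of_le_one {n : ℕ} (hn : n ≤ 1) : (digitSet n).ncard = (oddOctagon n).ncard + 1 := by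
  have hd : Disjoint (oddOctagon n) {0} := by
    rw [Set.disjoint_singleton_right]
    rintro ⟨_, hodd⟩
    exact hodd ⟨⟨0, rfl⟩, ⟨0, rfl⟩⟩
  rw [digitSet_eq_oddOctagon_union_of_le_one hn,
    Set.ncard_union_eq hd (oddOctagon_finite n) (Set.finite_singleton 0), Set.ncard_singleton]

/-- `B₀ = {0, ±1, ±i}` as a finite set. [cite: Graves2023, Def. 2.1 (p. 3)] -/
theorem digitSet_zero_eq : digitSet 0 = (({0, 1, -1, ⟨0, 1⟩, ⟨0, -1⟩} : Finset (ℤ√(-1))) : Set (ℤ√(-1))) := by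
  rw [digitSet_zero, digits]
  simp only [Finset.coe_insert, Finset.coe_singleton]

/-- `|B₀| = 5` (`= a(1)`), by listing; `|B₁| = 17 = a(2)` is `ncard_digitSet_one` of
`GaussianMinimalEuclideanFunction.lean`. [cite: Graves2026, Cor. 2.5] -/
theorem ncard_digitSet_zero : (digitSet 0).ncard = 5 := by
  rw [digitSet_zero_eq, Set.ncard_coe_finset]
  decide

/-- `(2^j s).re = 2^j s.re` and `(2^j s).im = 2^j s.im`. [folklore] -/
private theorem re_im_two_pow_mul (j : ℕ) (s : ℤ√(-1)) :
    (2 ^ j * s).re = 2 ^ j * s.re ∧ (2 ^ j * s).im = 2 ^ j * s.im := by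
  induction j with
  | zero => simp
  | succ j ih =>
    have hre : (2 * (2 ^ j * s)).re = 2 * (2 ^ j * s).re := by simp
    have him : (2 * (2 ^ j * s)).im = 2 * (2 ^ j * s).im := by simp
    rw [pow_succ', mul_assoc, hre, him, ih.1, ih.2, pow_succ']
    constructor <;> ring

/-- **Theorem 2.4** (membership form): a non-zero `z` lies in `B_n = φ_{ℤ[i]}^{-1}([0,n])` iff `z = 2^j s` with
`2j ≤ n` and `s ∈ S_{n−2j}` (take `2^j ∥ z`). [cite: Graves2026, Thm. 2.4] -/
theorem mem_digitSet_iff_exists_two_pow_mul {n : ℕ} {z : ℤ√(-1)} (hz : z ≠ 0) :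
    z ∈ digitSet n ↔ ∃ j : ℕ, 2 * j ≤ n ∧ ∃ s ∈ oddOctagon (n - 2 * j), z = 2 ^ j * s := by
  constructor
  · intro hzB
    have hxy : ¬(z.re = 0 ∧ z.im = 0) := fun h ↦ hz (Zsqrtd.ext h.1 h.2)
    obtain ⟨k, ⟨hk1, hk2⟩, hk'⟩ := exists_exact_two_pow hxy
    obtain ⟨s, hs, hre, him⟩ := eq_two_pow_mul hk1 hk2
    have hs0 : s ≠ 0 := by rintro rfl; rw [mul_zero] at hs; exact hz hs
    have hodd : ¬(2 ∣ s.re ∧ 2 ∣ s.im) := by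
      rintro ⟨⟨a, ha⟩, ⟨b, hb⟩⟩
      refine hk' ⟨⟨a, ?_⟩, ⟨b, ?_⟩⟩
      · rw [hre, ha, pow_succ]; ring
      · rw [him, hb, pow_succ]; ring
    by_cases hkn : 2 * k ≤ n
    · refine ⟨k, hkn, s, ?_, hs⟩
      rw [mem_oddOctagon_iff_mem_digitSet]
      refine ⟨?_, hodd⟩
      obtain ⟨m, hm⟩ := Nat.exists_eq_add_of_le hkn
      rw [hm, add_comm, hs, two_pow_mul_mem_digitSet_iff] at hzB
      rwa [hm, Nat.add_sub_cancel_left]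
    · exact absurd (hs ▸ hzB) (two_pow_mul_not_mem_digitSet hs0 (by omega))
  · rintro ⟨j, hj, s, hs, rfl⟩
    obtain ⟨m, hm⟩ := Nat.exists_eq_add_of_le hj
    rw [hm, Nat.add_sub_cancel_left, mem_oddOctagon_iff_mem_digitSet] at hs
    rw [hm, add_comm, two_pow_mul_mem_digitSet_iff]
    exact hs.1

/-- **Theorem 2.4** as printed: «`φ_{ℤ[i]}^{-1}([0,n]) ∖ {0} = ⊔_{j=0}^{⌊n/2⌋} 2^j S_{n−2j}`» (with
`φ_{ℤ[i]}^{-1}([0,n]) = B_n`, `setOf_motzkinNorm_le_eq_digitSet`). [cite: Graves2026, Thm. 2.4] -/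
theorem digitSet_diff_zero_eq_iUnion (n : ℕ) :
    digitSet n \ {0} = ⋃ j ∈ Finset.range (n / 2 + 1), (fun s ↦ 2 ^ j * s) '' oddOctagon (n - 2 * j) := by
  ext z
  simp only [Set.mem_sdiff, Set.mem_singleton_iff, Set.mem_iUnion, Finset.mem_range, Set.mem_image, exists_prop]
  constructor
  · rintro ⟨hzB, hz⟩
    obtain ⟨j, hj, s, hs, rfl⟩ := (mem_digitSet_iff_exists_two_pow_mul hz).mp hzB
    exact ⟨j, by omega, s, hs, rfl⟩
  · rintro ⟨j, hj, s, hs, rfl⟩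
    have hs0 : (2 : ℤ√(-1)) ^ j * s ≠ 0 := by
      refine mul_ne_zero (pow_ne_zero j (by decide)) ?_
      rintro rfl
      exact hs.2 ⟨⟨0, rfl⟩, ⟨0, rfl⟩⟩
    exact ⟨(mem_digitSet_iff_exists_two_pow_mul hs0).mpr ⟨j, by omega, s, hs, rfl⟩, hs0⟩

/-- The union in Theorem 2.4 is disjoint: `j` and the part `s` prime to `2` are determined by `z = 2^j s`
(`2^j ∥ z`). [cite: Graves2026, Thm. 2.4] -/
theorem two_pow_mul_eq_two_pow_mul_iff {j j' m m' : ℕ} {s s' : ℤ√(-1)} (hs : s ∈ oddOctagon m)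
    (hs' : s' ∈ oddOctagon m') : (2 : ℤ√(-1)) ^ j * s = 2 ^ j' * s' ↔ j = j' ∧ s = s' := by
  refine ⟨fun h ↦ ?_, by rintro ⟨rfl, rfl⟩; rfl⟩
  have key : ∀ {j : ℕ} {s : ℤ√(-1)}, ¬(2 ∣ s.re ∧ 2 ∣ s.im) →
      ((2 : ℤ) ^ j ∣ (2 ^ j * s).re ∧ (2 : ℤ) ^ j ∣ (2 ^ j * s).im) ∧
        ¬((2 : ℤ) ^ (j + 1) ∣ (2 ^ j * s).re ∧ (2 : ℤ) ^ (j + 1) ∣ (2 ^ j * s).im) := by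
    intro j s hodd
    obtain ⟨hre, him⟩ := re_im_two_pow_mul j s
    rw [hre, him]
    refine ⟨⟨dvd_mul_right _ _, dvd_mul_right _ _⟩, fun ⟨h1, h2⟩ ↦ hodd ⟨?_, ?_⟩⟩
    · rw [pow_succ] at h1
      exact (mul_dvd_mul_iff_left (pow_ne_zero j two_ne_zero)).mp h1
    · rw [pow_succ] at h2
      exact (mul_dvd_mul_iff_left (pow_ne_zero j two_ne_zero)).mp h2
  obtain ⟨h1, h1'⟩ := key (j := j) hs.2
  obtain ⟨h2, h2'⟩ := key (j := j') hs'.2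
  rw [h] at h1 h1'
  have hjj : j = j' := exact_two_pow_unique h1 h1' h2 h2'
  subst hjj
  exact ⟨rfl, mul_left_cancel₀ (pow_ne_zero j (by decide)) h⟩

/-- **Corollary 2.5.** «`a_{n+1} = |φ_{ℤ[i]}^{-1}([0,n])| = 1 + Σ_{j=0}^{⌊n/2⌋} |S_{n−2j}|`.» [cite: Graves2026, Cor. 2.5] -/
theorem ncard_digitSet_eq_one_add_sum (n : ℕ) :
    (digitSet n).ncard = 1 + ∑ j ∈ Finset.range (n / 2 + 1), (oddOctagon (n - 2 * j)).ncard := by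
  induction n using Nat.twoStepInduction with
  | zero =>
    rw [Nat.zero_div, zero_add, Finset.sum_range_one, Nat.mul_zero, Nat.sub_zero,
      ncard_digitSet_of_le_one (Nat.zero_le 1), add_comm]
  | one =>
    rw [show 1 / 2 + 1 = 1 by rfl, Finset.sum_range_one, Nat.mul_zero, Nat.sub_zero,
      ncard_digitSet_of_le_one le_rfl, add_comm]
  | more n ih _ =>
    rw [ncard_digitSet_add_two, ih, show (n + 2) / 2 + 1 = (n / 2 + 1) + 1 by omega,
      Finset.sum_range_succ' (fun j ↦ (oddOctagon (n + 2 - 2 * j)).ncard)]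
    simp only [Nat.mul_zero, Nat.sub_zero, show ∀ j, n + 2 - 2 * (j + 1) = n - 2 * j from fun j ↦ by omega]
    ring

/-! ## §4 Theorems 4.1 and 4.2: `|B_n|` in closed form -/

/-- **Theorem 4.1** (for all `k ≥ 0`; printed for `k ≥ 1`): `|B_{2k}| = |φ_{ℤ[i]}^{-1}([0,2k])| =
25 + 8k − 48·2^k + 28·4^k` (Israel's `a(2k+1)`).  By induction on `k` from `|B_{2k+2}| = |S_{2k+2}| + |B_{2k}|`
and Lemma 3.4 with `w_{2k+2} = 6·2^k`, `w_{2k+1} = 4·2^k`. [cite: Graves2026, Thm. 4.1] -/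
theorem ncard_digitSet_two_mul (k : ℕ) :
    ((digitSet (2 * k)).ncard : ℤ) = 28 * 4 ^ k - 48 * 2 ^ k + 8 * k + 25 := by
  induction k with
  | zero => rw [Nat.mul_zero, ncard_digitSet_zero]; norm_num
  | succ k ih =>
    have hrec := ncard_digitSet_add_two (2 * k)
    have hS := ncard_oddOctagon_succ (2 * k + 1)
    rw [show 2 * k + 1 + 1 = 2 * k + 2 by rfl, width_two_mul_add_one,
      show width (2 * k + 2) = 3 * 2 ^ (k + 1) from width_two_mul (k + 1)] at hS
    have h4 : (4 : ℤ) ^ k = 2 ^ k * 2 ^ k := by rw [← mul_pow]; norm_num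
    have e2 : (2 : ℤ) ^ (k + 1) = 2 * 2 ^ k := by ring
    have e4 : (4 : ℤ) ^ (k + 1) = 4 * (2 ^ k * 2 ^ k) := by rw [pow_succ, h4]; ring
    rw [show 2 * (k + 1) = 2 * k + 2 by ring, hrec, Nat.cast_add, ih, hS, e2, e4, h4]
    push_cast
    ring

/-- **Theorem 4.2**, CORRECTED (for all `k ≥ 0`; printed for `k ≥ 1` with the misprint `28·4^k` for `56·4^k`,
see the module docstring): `|B_{2k+1}| = |φ_{ℤ[i]}^{-1}([0,2k+1])| = 29 + 8k − 68·2^k + 56·4^k` (Israel's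
`a(2k+2)`).  By induction on `k` from `|B_{2k+3}| = |S_{2k+3}| + |B_{2k+1}|` and Lemma 3.4 with
`w_{2k+3} = 8·2^k`, `w_{2k+2} = 6·2^k` (`|B₁| = |S₁| + 1 = 17`). [cite: Graves2026, Thm. 4.2] -/
theorem ncard_digitSet_two_mul_add_one (k : ℕ) :
    ((digitSet (2 * k + 1)).ncard : ℤ) = 56 * 4 ^ k - 68 * 2 ^ k + 8 * k + 29 := by
  induction k with
  | zero =>
    have hS := ncard_oddOctagon_succ 0
    rw [Nat.mul_zero, Nat.zero_add, ncard_digitSet_of_le_one le_rfl, Nat.cast_add, hS]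
    simp
  | succ k ih =>
    have hrec := ncard_digitSet_add_two (2 * k + 1)
    have hS := ncard_oddOctagon_succ (2 * k + 2)
    rw [show 2 * k + 2 + 1 = 2 * (k + 1) + 1 by ring, width_two_mul_add_one,
      show width (2 * k + 2) = 3 * 2 ^ (k + 1) from width_two_mul (k + 1)] at hS
    have h4 : (4 : ℤ) ^ k = 2 ^ k * 2 ^ k := by rw [← mul_pow]; norm_num
    have e2 : (2 : ℤ) ^ (k + 1) = 2 * 2 ^ k := by ring
    have e4 : (4 : ℤ) ^ (k + 1) = 4 * (2 ^ k * 2 ^ k) := by rw [pow_succ, h4]; ring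
    rw [show 2 * (k + 1) + 1 = 2 * k + 1 + 2 by ring, hrec, Nat.cast_add, ih,
      show 2 * k + 1 + 2 = 2 * (k + 1) + 1 by ring, hS, e2, e4, h4]
    push_cast
    ring

/-- Israel's first formula, as quoted in the paper: «`a(2k+1) = 28·4^k − 48·2^k + 8·k + 25`», where
`a(n+1) = |φ_{ℤ[i]}^{-1}([0,n])| = |B_n|`; i.e. `|B_{2k}|`. [cite: Graves2026, §1] -/
theorem ncard_digitSet_israel_odd_index (k : ℕ) :
    ((digitSet (2 * k)).ncard : ℤ) = 28 * 4 ^ k - 48 * 2 ^ k + 8 * k + 25 := ncard_digitSet_two_mul k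

/-- Israel's second formula, as quoted in the paper: «`a(2k) = 14·4^k − 34·2^k + 8·k + 21`» (`k ≥ 1`), i.e.
`|B_{2k−1}|`; here with `k+1` for `k`: `|B_{2k+1}| = 14·4^{k+1} − 34·2^{k+1} + 8(k+1) + 21` («so our formulas
match»). [cite: Graves2026, §1] -/
theorem ncard_digitSet_israel_even_index (k : ℕ) :
    ((digitSet (2 * k + 1)).ncard : ℤ) = 14 * 4 ^ (k + 1) - 34 * 2 ^ (k + 1) + 8 * (k + 1) + 21 := by
  rw [ncard_digitSet_two_mul_add_one, pow_succ, pow_succ]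
  ring

/-- Cross-check of the corrected constant: `|B₃| = 125` and `|B₅| = 669` (`56·4^k`, not `28·4^k`).
[cite: Graves2026, Thm. 4.2] -/
theorem ncard_digitSet_three_five : (digitSet 3).ncard = 125 ∧ (digitSet 5).ncard = 669 := by
  have h3 := ncard_digitSet_two_mul_add_one 1
  have h5 := ncard_digitSet_two_mul_add_one 2
  norm_num at h3 h5
  exact ⟨by exact_mod_cast h3, by exact_mod_cast h5⟩

/-! ## §5 The pre-images of the minimal Euclidean function `φ_{ℤ[i]}` -/

/-- `φ_{ℤ[i]}^{-1}([0,n]) = B_n` («the same paper introduced a geometric description for `φ_{ℤ[i]}^{-1}([0,n])`»: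
Theorem 5.3 of [Graves2023], plus `φ_{ℤ[i]}(0) = 0`). [cite: Graves2026, §1] -/
theorem setOf_motzkinNorm_le_eq_digitSet (n : ℕ) :
    {z : ℤ√(-1) | motzkinNorm forall_exists_not_mem_motzkinSet z ≤ n} = digitSet n := by
  ext z
  rw [Set.mem_setOf_eq]
  by_cases hz : z = 0
  · subst hz
    have h0 : motzkinRank forall_exists_not_mem_motzkinSet (0 : ℤ√(-1)) = 0 :=
      (motzkinRank_eq_zero_iff _).mpr rfl
    simp only [zero_mem_digitSet, iff_true]
    unfold motzkinNorm
    omega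
  · exact motzkinNorm_le_iff_mem_digitSet hz n

/-- Lenstra's description of `φ_{ℤ[i]}`, as quoted in the paper: «`φ_{ℤ[i]}(x+yi) = min{n : ∃ u_j … such that
Σ_{j=0}^n u_j (1+i)^j = x+yi}`» — `φ_{ℤ[i]}(z)` is the LEAST `n` with `z ∈ B_n`, i.e. one less than the number of
digits of a shortest `(1+i)`-ary expansion of `z` with digits `0, ±1, ±i` (`mem_digitSet_iff_exists_sum`; also for
`z = 0`, where `φ(0) = 0`). [cite: Graves2026, §1] -/
theorem isLeast_motzkinNorm (z : ℤ√(-1)) :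
    IsLeast {n : ℕ | z ∈ digitSet n} (motzkinNorm forall_exists_not_mem_motzkinSet z) := by
  have key : ∀ n, z ∈ digitSet n ↔ motzkinNorm forall_exists_not_mem_motzkinSet z ≤ n := fun n ↦ by
    rw [← setOf_motzkinNorm_le_eq_digitSet n]; rfl
  exact ⟨(key _).mpr le_rfl, fun n hn ↦ (key n).mp hn⟩

/-- The same with the expansions spelled out: `φ_{ℤ[i]}(z)` is the least `n` such that
`z = Σ_{j=0}^{n} v_j (1+i)^j` with all `v_j ∈ {0, ±1, ±i}`. [cite: Graves2026, §1] -/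
theorem isLeast_motzkinNorm_expansion (z : ℤ√(-1)) :
    IsLeast {n : ℕ | ∃ v : ℕ → ℤ√(-1), (∀ j ≤ n, v j ∈ digits) ∧
      z = ∑ j ∈ Finset.range (n + 1), v j * ⟨1, 1⟩ ^ j} (motzkinNorm forall_exists_not_mem_motzkinSet z) := by
  have h := isLeast_motzkinNorm z
  simp only [mem_digitSet_iff_exists_sum] at h
  exact h

/-- `φ_{ℤ[i]}^{-1}([0,n])` is finite. [cite: Graves2026, §1] -/
theorem setOf_motzkinNorm_le_finite (n : ℕ) :
    {z : ℤ√(-1) | motzkinNorm forall_exists_not_mem_motzkinSet z ≤ n}.Finite := by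
  rw [setOf_motzkinNorm_le_eq_digitSet]
  exact digitSet_finite n

/-- **Theorem 4.1** as printed (all `k ≥ 0`): «`|φ_{ℤ[i]}^{-1}([0,2k])| = 25 + 8k − 48·2^k + 28·4^k`.»
[cite: Graves2026, Thm. 4.1] -/
theorem ncard_setOf_motzkinNorm_le_two_mul (k : ℕ) :
    (({z : ℤ√(-1) | motzkinNorm forall_exists_not_mem_motzkinSet z ≤ 2 * k}).ncard : ℤ) =
      25 + 8 * k - 48 * 2 ^ k + 28 * 4 ^ k := by
  rw [setOf_motzkinNorm_le_eq_digitSet, ncard_digitSet_two_mul]; ring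

/-- **Theorem 4.2** with the corrected constant (all `k ≥ 0`): `|φ_{ℤ[i]}^{-1}([0,2k+1])| = 29 + 8k − 68·2^k + 56·4^k`.
[cite: Graves2026, Thm. 4.2] -/
theorem ncard_setOf_motzkinNorm_le_two_mul_add_one (k : ℕ) :
    (({z : ℤ√(-1) | motzkinNorm forall_exists_not_mem_motzkinSet z ≤ 2 * k + 1}).ncard : ℤ) =
      29 + 8 * k - 68 * 2 ^ k + 56 * 4 ^ k := by
  rw [setOf_motzkinNorm_le_eq_digitSet, ncard_digitSet_two_mul_add_one]; ring

/-- The level sets: `φ_{ℤ[i]}^{-1}(n+1) = B_{n+1} ∖ B_n`. [cite: Graves2023, Thm. 5.3 (p. 8)] -/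
theorem setOf_motzkinNorm_eq_succ (n : ℕ) :
    {z : ℤ√(-1) | motzkinNorm forall_exists_not_mem_motzkinSet z = n + 1} = digitSet (n + 1) \ digitSet n := by
  ext z
  rw [Set.mem_setOf_eq, Set.mem_sdiff, ← setOf_motzkinNorm_le_eq_digitSet, ← setOf_motzkinNorm_le_eq_digitSet,
    Set.mem_setOf_eq, Set.mem_setOf_eq]
  omega

/-- `|φ_{ℤ[i]}^{-1}(n+1)| = |B_{n+1}| − |B_n|` (first differences of Israel's `a`). [cite: Graves2026, Cor. 2.5] -/
theorem ncard_setOf_motzkinNorm_eq_succ (n : ℕ) :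
    (({z : ℤ√(-1) | motzkinNorm forall_exists_not_mem_motzkinSet z = n + 1}).ncard : ℤ) =
      (digitSet (n + 1)).ncard - (digitSet n).ncard := by
  rw [setOf_motzkinNorm_eq_succ]
  have := Set.ncard_sdiff_add_ncard_of_subset (digitSet_subset_succ n) (digitSet_finite (n + 1))
  omega

/-- `|φ_{ℤ[i]}^{-1}(0)| = |B₀| = 5` (`0` and the four units). [cite: Graves2026, Cor. 2.5] -/
theorem ncard_setOf_motzkinNorm_eq_zero :
    ({z : ℤ√(-1) | motzkinNorm forall_exists_not_mem_motzkinSet z = 0}).ncard = 5 := by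
  rw [← ncard_digitSet_zero, ← setOf_motzkinNorm_le_eq_digitSet 0]
  simp only [Nat.le_zero]

/-- `|φ_{ℤ[i]}^{-1}(2k+1)| = 28·4^k − 20·2^k + 4` (for `k = 0`: the `12` universal side divisors) — immediate from
Theorems 4.1–4.2. [cite: Graves2026, Thms. 4.1–4.2] -/
theorem ncard_setOf_motzkinNorm_eq_two_mul_add_one (k : ℕ) :
    (({z : ℤ√(-1) | motzkinNorm forall_exists_not_mem_motzkinSet z = 2 * k + 1}).ncard : ℤ) =
      28 * 4 ^ k - 20 * 2 ^ k + 4 := by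
  rw [ncard_setOf_motzkinNorm_eq_succ, ncard_digitSet_two_mul_add_one, ncard_digitSet_two_mul]; ring

/-- `|φ_{ℤ[i]}^{-1}(2k+2)| = 56·4^k − 28·2^k + 4` — immediate from Theorems 4.1–4.2. [cite: Graves2026, Thms. 4.1–4.2] -/
theorem ncard_setOf_motzkinNorm_eq_two_mul_add_two (k : ℕ) :
    (({z : ℤ√(-1) | motzkinNorm forall_exists_not_mem_motzkinSet z = 2 * k + 2}).ncard : ℤ) =
      56 * 4 ^ k - 28 * 2 ^ k + 4 := by
  rw [ncard_setOf_motzkinNorm_eq_succ, show 2 * k + 2 = 2 * (k + 1) by ring, ncard_digitSet_two_mul,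
    ncard_digitSet_two_mul_add_one, pow_succ, pow_succ]
  push_cast
  ring

end Literature.NumberTheory.QuadraticFields.GaussianDigits
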